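import Summits.QuantumFields.YangMills.Theorems.BalabanLadderIRColdPurityBridge
import Literature.MathematicalPhysics.QuantumFieldTheory.WilsonFinTorusPartitionComplex
import HarnessLib

/-!
# The coupling derivative of the Wilson torus partition function and of the cold purity ratio
# (helper for crux `BalabanLadder.IR`, stmt-QuantumFields-19354; «action additivity» dictionary)

Landed under RULING g9-№2 on the invitation of ym-ir-crit-3 (`VERDICT-lipschitz-chain.md` P3: «the derivative identity
`∂_β log[Z(2t)/Z(t)²] = −(⟨S⟩_{2t} − 2⟨S⟩_t)` and differentiability are PROVABLE NOW … a landable support lemma»), from the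
ideator line `lipschitz-chain` (seat ym-ir-idea-12 g0).  Def-free; every statement is over tree names.

* `hasDerivAt_wilsonFinTorusPartition` — for continuous `ρ` and second-countable compact `G`, `β ↦ Z_β(n₀,n₁,n₂,n₃)`
  (`wilsonFinTorusPartition`) is differentiable on `ℝ` with derivative `−∫ S(U) e^{−β S(U)} dHaar(U)`, `S = finTorusWilsonAction`
  (differentiation under the integral sign: `|S| ≤ B` on the compact configuration space).
* `hasDerivAt_log_wilsonFinTorusPartition` — `d/dβ log Z_β = (−∫ S e^{−βS}) / Z_β = −⟨S⟩_β` (the action expectation).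
* `hasDerivAt_log_coldRatio` — for a `LatticeRep r`: `d/dβ log (Z_β(L,L,L,2m) / Z_β(L,L,L,m)²) = Z'_{2m}/Z_{2m} − 2·Z'_m/Z_m`, i.e.
  MINUS the ACTION-ADDITIVITY DEFECT `A(β) = ⟨S⟩_{β; L³×2m} − 2⟨S⟩_{β; L³×m}` under time doubling.  Since the cold purity defect is
  `δᶜ_β(L) = 1 − Z_β(L,L,L,2⌊L/4⌋)/Z_β(L,L,L,⌊L/4⌋)²` (`ColdPurityBridge.coldDefect`), this is the dictionary between the Lipschitz
  modulus of `β ↦ δᶜ_β(L)` (crux idea `lipschitz-chain`, stub LIP) and the Monte-Carlo observable «plaquette difference between the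
  `4:1` and the `2:1` torus» (Engels–Karsch–Satz differences method).

HONESTY.  Nothing here proves the Yang–Mills mass gap (Clay), a lattice gap, `BalabanLadder.IR` or any open item; R4 closes only the
conditional finite-𝕋⁴ rung `BalabanLadder.UV`.  These are calculus identities for a finite-dimensional compact-group integral.
-/

noncomputable section

open scoped Topology
open MeasureTheory Filter Metric
open Literature.MathematicalPhysics.QuantumFieldTheory Literature.MathematicalPhysics.QuantumLattice

namespace Summit.QuantumFields.YangMills.Cruxes.IR.CouplingAxis

section Rho

variable {G : Type*} [Group G] {n : ℕ} (ρ : G →* Matrix (Fin n) (Fin n) ℂ) [TopologicalSpace G]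
  [IsTopologicalGroup G] [CompactSpace G] [MeasurableSpace G] [BorelSpace G] [SecondCountableTopology G]

/-- **The Wilson partition function is differentiable in the coupling, with derivative `−∫ S e^{−βS}`**
(continuous `ρ`, second-countable compact `G`; differentiation under the integral sign against the product Haar
probability measure, the action `S = finTorusWilsonAction ρ` being continuous and bounded, `|S| ≤ B`). -/
theorem hasDerivAt_wilsonFinTorusPartition (hρ : Continuous ρ) (n₀ n₁ n₂ n₃ : ℕ) (β₀ : ℝ) :
    HasDerivAt (fun β : ℝ => wilsonFinTorusPartition ρ β n₀ n₁ n₂ n₃)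
      (∫ U, -finTorusWilsonAction ρ U * Real.exp (-(β₀ * finTorusWilsonAction ρ U))
        ∂(Measure.pi fun _ : FinTorusSite n₀ n₁ n₂ n₃ × Fin 4 => haarProbability G)) β₀ := by
  obtain ⟨B, hB⟩ := exists_abs_finTorusWilsonAction_le ρ hρ n₀ n₁ n₂ n₃
  have hB0 : 0 ≤ B := (abs_nonneg _).trans (hB (fun _ => 1))
  set μ : Measure (FinTorusSite n₀ n₁ n₂ n₃ × Fin 4 → G) := Measure.pi fun _ => haarProbability G with hμ
  haveI : IsFiniteMeasure μ := by rw [hμ]; infer_instance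
  set S : (FinTorusSite n₀ n₁ n₂ n₃ × Fin 4 → G) → ℝ := finTorusWilsonAction ρ with hS
  have hSc : Continuous S := continuous_finTorusWilsonAction ρ hρ
  set F : ℝ → (FinTorusSite n₀ n₁ n₂ n₃ × Fin 4 → G) → ℝ := fun β U => Real.exp (-(β * S U)) with hF
  set F' : ℝ → (FinTorusSite n₀ n₁ n₂ n₃ × Fin 4 → G) → ℝ := fun β U => -S U * Real.exp (-(β * S U)) with hF'
  have hFc : ∀ β, Continuous (F β) := fun β => by
    rw [hF]; exact Real.continuous_exp.comp (continuous_const.mul hSc).neg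
  have hF'c : ∀ β, Continuous (F' β) := fun β => by
    rw [hF']; exact hSc.neg.mul (hFc β)
  -- pointwise bound on the derivative on `ball β₀ 1`
  have hbound : ∀ U, ∀ β ∈ ball β₀ 1, ‖F' β U‖ ≤ B * Real.exp ((|β₀| + 1) * B) := by
    intro U β hβ
    have hβle : |β| ≤ |β₀| + 1 := by
      have h1 : |β - β₀| < 1 := by simpa [Real.dist_eq] using mem_ball.1 hβ
      have h2 := abs_sub_abs_le_abs_sub β β₀
      linarith
    rw [hF']
    simp only [norm_mul, norm_neg, Real.norm_eq_abs, Real.abs_exp]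
    refine mul_le_mul (hB U) (Real.exp_le_exp.2 ?_) (Real.exp_pos _).le hB0
    calc -(β * S U) ≤ |β * S U| := neg_le_abs _
      _ = |β| * |S U| := abs_mul _ _
      _ ≤ (|β₀| + 1) * B := mul_le_mul hβle (hB U) (abs_nonneg _) (by positivity)
  have key := hasDerivAt_integral_of_dominated_loc_of_deriv_le (μ := μ) (F := F) (F' := F') (x₀ := β₀)
    (s := ball β₀ 1) (bound := fun _ => B * Real.exp ((|β₀| + 1) * B)) (ball_mem_nhds β₀ one_pos)
    (Eventually.of_forall fun β => (hFc β).aestronglyMeasurable)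
    ((hFc β₀).integrable_of_hasCompactSupport
      (IsCompact.of_isClosed_subset isCompact_univ (isClosed_tsupport _) (Set.subset_univ _)))
    (hF'c β₀).aestronglyMeasurable (Eventually.of_forall hbound) (integrable_const _)
    (Eventually.of_forall fun U β _ => by
      rw [hF, hF']
      have h := ((hasDerivAt_id β).mul_const (S U)).neg.exp
      refine h.congr_deriv ?_
      simp only [id, Pi.neg_apply]
      ring)
  have hZ : (fun β : ℝ => wilsonFinTorusPartition ρ β n₀ n₁ n₂ n₃) = fun β => ∫ U, F β U ∂μ := by
    funext β
    rw [hF, hμ, hS]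
    unfold wilsonFinTorusPartition finTorusWilsonAction
    refine integral_congr_ae (Eventually.of_forall fun U => ?_)
    simp only [neg_mul]
  rw [hZ]
  have h2 := key.2
  rw [hF', hS, hμ] at h2
  exact h2

/-- **`d/dβ log Z_β = −⟨S⟩_β`**: the logarithmic coupling derivative of the Wilson torus partition function is
`(−∫ S e^{−βS} dHaar) / Z_β`, i.e. minus the action expectation. -/
theorem hasDerivAt_log_wilsonFinTorusPartition (hρ : Continuous ρ) (n₀ n₁ n₂ n₃ : ℕ) (β₀ : ℝ) :
    HasDerivAt (fun β : ℝ => Real.log (wilsonFinTorusPartition ρ β n₀ n₁ n₂ n₃))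
      ((∫ U, -finTorusWilsonAction ρ U * Real.exp (-(β₀ * finTorusWilsonAction ρ U))
        ∂(Measure.pi fun _ : FinTorusSite n₀ n₁ n₂ n₃ × Fin 4 => haarProbability G)) /
        wilsonFinTorusPartition ρ β₀ n₀ n₁ n₂ n₃) β₀ :=
  (hasDerivAt_wilsonFinTorusPartition ρ hρ n₀ n₁ n₂ n₃ β₀).log (wilsonFinTorusPartition_pos hρ β₀ n₀ n₁ n₂ n₃).ne'

end Rho

section Rep

variable {G : Type} [Group G] [TopologicalSpace G] [IsTopologicalGroup G] [CompactSpace G]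
  [MeasurableSpace G] [BorelSpace G]

/-- **Action additivity under time doubling = the coupling derivative of the cold purity ratio.**  For a `LatticeRep r`, side `L`
and time `m`: `β ↦ log (Z_β(L,L,L,2m) / Z_β(L,L,L,m)²)` is differentiable with derivative `Z'_{2m}/Z_{2m} − 2·(Z'_m/Z_m)`
(`Z' = −∫ S e^{−βS}`), which is `−(⟨S⟩_{β;L³×2m} − 2⟨S⟩_{β;L³×m})`: minus the action-additivity defect of the time-doubled torus. -/
theorem hasDerivAt_log_coldRatio (r : LatticeRep G) (L m : ℕ) (β₀ : ℝ) :
    HasDerivAt (fun β : ℝ => Real.log (wilsonFinTorusPartition r.ρ β L L L (2 * m) /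
        wilsonFinTorusPartition r.ρ β L L L m ^ 2))
      ((∫ U, -finTorusWilsonAction r.ρ U * Real.exp (-(β₀ * finTorusWilsonAction r.ρ U))
          ∂(Measure.pi fun _ : FinTorusSite L L L (2 * m) × Fin 4 => haarProbability G)) /
          wilsonFinTorusPartition r.ρ β₀ L L L (2 * m) -
        2 * ((∫ U, -finTorusWilsonAction r.ρ U * Real.exp (-(β₀ * finTorusWilsonAction r.ρ U))
          ∂(Measure.pi fun _ : FinTorusSite L L L m × Fin 4 => haarProbability G)) /
          wilsonFinTorusPartition r.ρ β₀ L L L m)) β₀ := by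
  haveI : SecondCountableTopology G :=
    (r.continuous.isClosedEmbedding r.injective).isEmbedding.secondCountableTopology
  have hpos : ∀ (k : ℕ) (β : ℝ), 0 < wilsonFinTorusPartition r.ρ β L L L k := fun k β =>
    wilsonFinTorusPartition_pos r.continuous β L L L k
  have h2 := hasDerivAt_log_wilsonFinTorusPartition r.ρ r.continuous L L L (2 * m) β₀
  have h1 := hasDerivAt_log_wilsonFinTorusPartition r.ρ r.continuous L L L m β₀
  have hfun : (fun β : ℝ => Real.log (wilsonFinTorusPartition r.ρ β L L L (2 * m) /
        wilsonFinTorusPartition r.ρ β L L L m ^ 2)) =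
      fun β : ℝ => Real.log (wilsonFinTorusPartition r.ρ β L L L (2 * m)) -
        2 * Real.log (wilsonFinTorusPartition r.ρ β L L L m) := by
    funext β
    rw [Real.log_div (hpos _ β).ne' (pow_ne_zero 2 (hpos _ β).ne'), Real.log_pow]
    push_cast
    ring
  rw [hfun]
  exact h2.sub (h1.const_mul 2)

/-- **The cold purity defect is differentiable in the coupling** (corollary: `δᶜ_β(L) = 1 − Z_β(2m)/Z_β(m)²`, `m = ⌊L/4⌋`, is a
rational function of differentiable, positive partition functions). -/
theorem differentiable_coldDefect (r : LatticeRep G) (L : ℕ) :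
    Differentiable ℝ fun β : ℝ => ColdPurityBridge.coldDefect r.ρ β L := by
  haveI : SecondCountableTopology G :=
    (r.continuous.isClosedEmbedding r.injective).isEmbedding.secondCountableTopology
  have hZ : ∀ k : ℕ, Differentiable ℝ fun β : ℝ => wilsonFinTorusPartition r.ρ β L L L k := fun k β =>
    (hasDerivAt_wilsonFinTorusPartition r.ρ r.continuous L L L k β).differentiableAt
  have hpos : ∀ (k : ℕ) (β : ℝ), wilsonFinTorusPartition r.ρ β L L L k ≠ 0 := fun k β =>
    (wilsonFinTorusPartition_pos r.continuous β L L L k).ne'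
  unfold ColdPurityBridge.coldDefect
  exact (differentiable_const _).sub ((hZ _).div ((hZ _).pow 2) fun β => pow_ne_zero 2 (hpos _ β))

end Rep

end Summit.QuantumFields.YangMills.Cruxes.IR.CouplingAxis

end
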